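import Summits.CriticalPhenomena.PercolationContinuityZ3.Theorems.PercNearOneGluingNoHeavyLowerTailGZGluing
import Summits.CriticalPhenomena.PercolationContinuityZ3.Theorems.PercNearOneGluingNoHeavyLowerTailGZParallel
import Literature.Probability.LatticeModels.ProdBernoulliIndependence
import HarnessLib

/-!
# `NoHeavyLowerTail` (stmt-CriticalPhenomena-4575) — support file: the PARALLEL COMPOSITION LAW at measure level and
# the parallel closure of `Cov(1{a↔c},1{b↔c}) ≤ P(ab|c)·log(P(a ↔ b off c)/P(ab|c))` for actual weighted graphs
# (prover `prim-ineq-prove-2` gen 11; THEOREM-SP.md §2 (PAR), §3, §4)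

No definitions, no named facts, no sorries.  A sub-network is an edge set `E ⊆ Sym2 V`; its events are read on
`ω ∩ E` under `prodBernoulli w`: `Aᶜ_E = {a ↮ c}`, `Bᶜ_E = {b ↮ c}`, `D_E = {a ↮ b}`, `T_E = {a ↔ b off c}` (edges at
`c` removed).  With `z = P(Aᶜ∩Bᶜ)`, `ā = P(D∩Aᶜ)`, `b̄ = P(D∩Bᶜ)`, `n = P(D∩Aᶜ∩Bᶜ)`, `θ = P(T)`, `w = z − n = P(ab|c)`:
`Cov(1{a↔c},1{b↔c}) = z − P(Aᶜ)P(Bᶜ)`.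

* `GZGluingLaw.network_facts` — for every sub-network: `P(Aᶜ) = z + ā − n`, `P(Bᶜ) = z + b̄ − n`, `n ≤ ā`, `n ≤ b̄`,
  `n ≤ z`, `z − n ≤ θ`, `θ + ā + b̄ − n ≤ 1`, and the two HARRIS constraints `P(Aᶜ)·b̄ ≤ n`, `P(Bᶜ)·ā ≤ n`;
* `GZGluingLaw.parallel_law` — for two edge-DISJOINT sub-networks on vertex sets meeting inside `{a, b, c}`:
  `z = z₁z₂`, `ā = ā₁ā₂`, `b̄ = b̄₁b̄₂`, `n = n₁n₂`, `1 − θ = (1 − θ₁)(1 − θ₂)` (independence + `GZGluing`);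
* `GZGluingLaw.parallel_cov_le` — **the parallel step of THEOREM SP for weighted graphs**: if both sub-networks satisfy
  the logarithmic covariance bound (and are non-degenerate: `n_i > 0`, `w_i > 0`) then so does their union.
-/

noncomputable section

namespace Summit.CriticalPhenomena.PercolationContinuityZ3.Theorems

open MeasureTheory Literature.Probability.LatticeModels Literature.Probability.Percolation
open scoped Classical

namespace GZGluingLaw

variable {V : Type*} [Fintype V]

omit [Fintype V] in
/-- If `a ↔ b` and `a ↮ c` in a configuration `η`, then `a ↔ b` already in `η` with the edges at `c` removed
(an open `a–b` walk meeting `c` would join `a` to `c`). [folklore] -/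
theorem reach_off_of_reach {η : Set (Sym2 V)} {a b c : V} (hab : (openGraph η).Reachable a b)
    (hac : ¬(openGraph η).Reachable a c) : (openGraph (η \ {e : Sym2 V | c ∈ e})).Reachable a b := by
  obtain ⟨p⟩ := hab
  suffices H : ∀ {x y : V} (_ : (openGraph η).Walk x y), ¬(openGraph η).Reachable x c →
      (openGraph (η \ {e : Sym2 V | c ∈ e})).Reachable x y from H p hac
  intro x y q
  induction q with
  | nil => intro; exact SimpleGraph.Reachable.refl _
  | @cons u v _ hadj q ih =>
    intro huc
    have hvc : ¬(openGraph η).Reachable v c := fun h => huc (hadj.reachable.trans h)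
    rw [openGraph_adj] at hadj
    have hu : u ≠ c := fun h => huc (h ▸ SimpleGraph.Reachable.refl _)
    have hv : v ≠ c := fun h => hvc (h ▸ SimpleGraph.Reachable.refl _)
    have hedge : (openGraph (η \ {e : Sym2 V | c ∈ e})).Adj u v := by
      rw [openGraph_adj]
      refine ⟨⟨hadj.1, ?_⟩, hadj.2⟩
      intro hc
      rcases Sym2.mem_iff.1 hc with h | h
      · exact hu h.symm
      · exact hv h.symm
    exact hedge.reachable.trans (ih hvc)

/-- **Cell facts of a sub-network `E`** (events read on `ω ∩ E`): the inclusion–exclusion identities for `P(a ↮ c)`,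
`P(b ↮ c)`, the order relations among the cells, and the two Harris constraints `P(a ↮ c)·P(b isolated) ≤ P(a|b|c)`,
`P(b ↮ c)·P(a isolated) ≤ P(a|b|c)` (Harris' inequality for decreasing events). [folklore] -/
theorem network_facts (w : Sym2 V → unitInterval) (E : Set (Sym2 V)) {a b c : V} (hac : a ≠ c)
    {Ac Bc D T : Set (Set (Sym2 V))}
    (hAc : Ac = {ω | ¬(openGraph (ω ∩ E)).Reachable a c}) (hBc : Bc = {ω | ¬(openGraph (ω ∩ E)).Reachable b c})
    (hD : D = {ω | ¬(openGraph (ω ∩ E)).Reachable a b})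
    (hT : T = {ω | (openGraph ((ω ∩ E) \ {e : Sym2 V | c ∈ e})).Reachable a b}) :
    (prodBernoulli w).real Ac = (prodBernoulli w).real (Ac ∩ Bc) + (prodBernoulli w).real (D ∩ Ac) -
        (prodBernoulli w).real (D ∩ Ac ∩ Bc) ∧
    (prodBernoulli w).real Bc = (prodBernoulli w).real (Ac ∩ Bc) + (prodBernoulli w).real (D ∩ Bc) -
        (prodBernoulli w).real (D ∩ Ac ∩ Bc) ∧
    (prodBernoulli w).real (D ∩ Ac ∩ Bc) ≤ (prodBernoulli w).real (D ∩ Ac) ∧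
    (prodBernoulli w).real (D ∩ Ac ∩ Bc) ≤ (prodBernoulli w).real (D ∩ Bc) ∧
    (prodBernoulli w).real (D ∩ Ac ∩ Bc) ≤ (prodBernoulli w).real (Ac ∩ Bc) ∧
    (prodBernoulli w).real (Ac ∩ Bc) - (prodBernoulli w).real (D ∩ Ac ∩ Bc) ≤ (prodBernoulli w).real T ∧
    (prodBernoulli w).real T + (prodBernoulli w).real (D ∩ Ac) + (prodBernoulli w).real (D ∩ Bc) -
        (prodBernoulli w).real (D ∩ Ac ∩ Bc) ≤ 1 ∧
    (prodBernoulli w).real Ac * (prodBernoulli w).real (D ∩ Bc) ≤ (prodBernoulli w).real (D ∩ Ac ∩ Bc) ∧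
    (prodBernoulli w).real Bc * (prodBernoulli w).real (D ∩ Ac) ≤ (prodBernoulli w).real (D ∩ Ac ∩ Bc) := by
  have _hunused := hac
  subst hAc hBc hD hT
  set Ac : Set (Set (Sym2 V)) := {ω | ¬(openGraph (ω ∩ E)).Reachable a c} with hAc
  set Bc : Set (Set (Sym2 V)) := {ω | ¬(openGraph (ω ∩ E)).Reachable b c} with hBc
  set D : Set (Set (Sym2 V)) := {ω | ¬(openGraph (ω ∩ E)).Reachable a b} with hD
  set T : Set (Set (Sym2 V)) := {ω | (openGraph ((ω ∩ E) \ {e : Sym2 V | c ∈ e})).Reachable a b} with hT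
  set μ := prodBernoulli w with hμ
  have hm : ∀ S : Set (Set (Sym2 V)), MeasurableSet S := fun S => MeasurableSet.of_discrete
  -- set relations
  have hAc2 : Ac = (Ac ∩ Bc) ∪ (D ∩ Ac) := by
    ext ω
    simp only [hAc, hBc, hD, Set.mem_inter_iff, Set.mem_union, Set.mem_setOf_eq]
    constructor
    · intro hac'
      by_cases hbc' : (openGraph (ω ∩ E)).Reachable b c
      · exact Or.inr ⟨fun hab => hac' (hab.trans hbc'), hac'⟩
      · exact Or.inl ⟨hac', hbc'⟩
    · rintro (⟨h, -⟩ | ⟨-, h⟩) <;> exact h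
  have hBc2 : Bc = (Ac ∩ Bc) ∪ (D ∩ Bc) := by
    ext ω
    simp only [hAc, hBc, hD, Set.mem_inter_iff, Set.mem_union, Set.mem_setOf_eq]
    constructor
    · intro hbc'
      by_cases hac' : (openGraph (ω ∩ E)).Reachable a c
      · exact Or.inr ⟨fun hab => hbc' (hab.symm.trans hac'), hbc'⟩
      · exact Or.inl ⟨hac', hbc'⟩
    · rintro (⟨-, h⟩ | ⟨-, h⟩) <;> exact h
  have hI1 : (Ac ∩ Bc) ∩ (D ∩ Ac) = D ∩ Ac ∩ Bc := by ext ω; simp only [Set.mem_inter_iff]; tauto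
  have hI2 : (Ac ∩ Bc) ∩ (D ∩ Bc) = D ∩ Ac ∩ Bc := by ext ω; simp only [Set.mem_inter_iff]; tauto
  have hZT : (Ac ∩ Bc) \ (D ∩ Ac ∩ Bc) ⊆ T := by
    rintro ω ⟨⟨hac', hbc'⟩, hN⟩
    have hab : (openGraph (ω ∩ E)).Reachable a b := by
      by_contra h
      exact hN ⟨⟨h, hac'⟩, hbc'⟩
    exact reach_off_of_reach hab hac'
  have hTD : Disjoint T ((D ∩ Ac) ∪ (D ∩ Bc)) := by
    rw [Set.disjoint_left]
    rintro ω hT (⟨hD, -⟩ | ⟨hD, -⟩) <;>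
      exact hD ((show (openGraph ((ω ∩ E) \ {e : Sym2 V | c ∈ e})).Reachable a b from hT).mono
        (openGraph_mono Set.sdiff_subset))
  have hI3 : (D ∩ Ac) ∩ (D ∩ Bc) = D ∩ Ac ∩ Bc := by ext ω; simp only [Set.mem_inter_iff]; tauto
  -- Harris: decreasing events
  have hlow : ∀ x y : V, IsLowerSet {ω : Set (Sym2 V) | ¬(openGraph (ω ∩ E)).Reachable x y} := by
    intro x y ω ω' hle hω h
    exact hω (h.mono (openGraph_mono (Set.inter_subset_inter_left E hle)))
  have hlowAc : IsLowerSet Ac := hlow a c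
  have hlowBc : IsLowerSet Bc := hlow b c
  have hlowDAc : IsLowerSet (D ∩ Ac) := (hlow a b).inter (hlow a c)
  have hlowDBc : IsLowerSet (D ∩ Bc) := (hlow a b).inter (hlow b c)
  have hH3 := prodBernoulli_harris_lower w hlowAc hlowDBc (hm _) (hm _)
  have hH4 := prodBernoulli_harris_lower w hlowBc hlowDAc (hm _) (hm _)
  have hN3 : Ac ∩ (D ∩ Bc) = D ∩ Ac ∩ Bc := by ext ω; simp only [Set.mem_inter_iff]; tauto
  have hN4 : Bc ∩ (D ∩ Ac) = D ∩ Ac ∩ Bc := by ext ω; simp only [Set.mem_inter_iff]; tauto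
  rw [hN3] at hH3
  rw [hN4] at hH4
  -- inclusion–exclusion
  have hie1 : μ.real ((Ac ∩ Bc) ∪ (D ∩ Ac)) + μ.real ((Ac ∩ Bc) ∩ (D ∩ Ac)) = μ.real (Ac ∩ Bc) + μ.real (D ∩ Ac) :=
    measureReal_union_add_inter (hm _)
  have hie2 : μ.real ((Ac ∩ Bc) ∪ (D ∩ Bc)) + μ.real ((Ac ∩ Bc) ∩ (D ∩ Bc)) = μ.real (Ac ∩ Bc) + μ.real (D ∩ Bc) :=
    measureReal_union_add_inter (hm _)
  have hie3 : μ.real ((D ∩ Ac) ∪ (D ∩ Bc)) + μ.real ((D ∩ Ac) ∩ (D ∩ Bc)) = μ.real (D ∩ Ac) + μ.real (D ∩ Bc) :=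
    measureReal_union_add_inter (hm _)
  rw [hI1, ← hAc2] at hie1
  rw [hI2, ← hBc2] at hie2
  rw [hI3] at hie3
  have hunion : μ.real (T ∪ ((D ∩ Ac) ∪ (D ∩ Bc))) = μ.real T + μ.real ((D ∩ Ac) ∪ (D ∩ Bc)) :=
    measureReal_union hTD (hm _)
  have hle1 : μ.real (T ∪ ((D ∩ Ac) ∪ (D ∩ Bc))) ≤ 1 := measureReal_le_one
  refine ⟨by linarith, by linarith, ?_, ?_, ?_, ?_, by linarith, hH3, hH4⟩
  · exact measureReal_mono (fun ω hω => hω.1) (by finiteness)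
  · exact measureReal_mono (fun ω hω => ⟨hω.1.1, hω.2⟩) (by finiteness)
  · exact measureReal_mono (fun ω hω => ⟨hω.1.2, hω.2⟩) (by finiteness)
  · have h1 : μ.real ((Ac ∩ Bc) \ (D ∩ Ac ∩ Bc)) ≤ μ.real T := measureReal_mono hZT (by finiteness)
    have h2 : μ.real ((Ac ∩ Bc) \ (D ∩ Ac ∩ Bc)) = μ.real (Ac ∩ Bc) - μ.real (D ∩ Ac ∩ Bc) :=
      measureReal_sdiff (fun ω hω => ⟨hω.1.2, hω.2⟩) (hm _)
    linarith

omit [Fintype V] in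
/-- Events read on `ω ∩ E` are determined by the coordinates in `E`. [folklore] -/
theorem determinedBy_restrict (Φ : Set (Sym2 V) → Prop) (E : Finset (Sym2 V)) :
    DeterminedBy {ω : Set (Sym2 V) | Φ (ω ∩ ↑E)} (↑E : Set (Sym2 V)) := by
  rw [determinedBy_iff]
  intro ω ω' h
  simp only [Set.mem_setOf_eq, h]

/-- Independence of restricted events on disjoint edge sets: `P(A₁ ∩ A₂) = P(A₁)·P(A₂)`. [folklore] -/
theorem real_inter_restrict (w : Sym2 V → unitInterval) {E₁ E₂ : Finset (Sym2 V)} (hdisj : Disjoint E₁ E₂)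
    (Φ Ψ : Set (Sym2 V) → Prop) :
    (prodBernoulli w).real ({ω : Set (Sym2 V) | Φ (ω ∩ ↑E₁)} ∩ {ω : Set (Sym2 V) | Ψ (ω ∩ ↑E₂)}) =
      (prodBernoulli w).real {ω : Set (Sym2 V) | Φ (ω ∩ ↑E₁)} * (prodBernoulli w).real {ω : Set (Sym2 V) | Ψ (ω ∩ ↑E₂)} :=
  prodBernoulli_real_inter_of_determinedBy_disjoint w hdisj (determinedBy_restrict Φ E₁) (determinedBy_restrict Ψ E₂)
    MeasurableSet.of_discrete MeasurableSet.of_discrete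


section parallel

variable {E₁ E₂ : Finset (Sym2 V)} {V₁ V₂ : Set V} {a b c : V}

omit [Fintype V] in
/-- **`P(a ↮ c, b ↮ c)` event of the union = intersection of the parts' events.** [folklore] -/
theorem Z_union_eq (h₁ : ∀ e ∈ (↑E₁ : Set (Sym2 V)), ∀ z ∈ e, z ∈ V₁) (h₂ : ∀ e ∈ (↑E₂ : Set (Sym2 V)), ∀ z ∈ e, z ∈ V₂)
    (hS : V₁ ∩ V₂ ⊆ {a, b, c}) (hac : a ≠ c) (hbc : b ≠ c) :
    ({ω : Set (Sym2 V) | ¬(openGraph (ω ∩ ((↑E₁ : Set (Sym2 V)) ∪ ↑E₂))).Reachable a c} ∩ {ω : Set (Sym2 V) | ¬(openGraph (ω ∩ ((↑E₁ : Set (Sym2 V)) ∪ ↑E₂))).Reachable b c}) =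
      ({ω : Set (Sym2 V) | ¬(openGraph (ω ∩ (↑E₁ : Set (Sym2 V)))).Reachable a c} ∩ {ω : Set (Sym2 V) | ¬(openGraph (ω ∩ (↑E₁ : Set (Sym2 V)))).Reachable b c}) ∩
        ({ω : Set (Sym2 V) | ¬(openGraph (ω ∩ (↑E₂ : Set (Sym2 V)))).Reachable a c} ∩ {ω : Set (Sym2 V) | ¬(openGraph (ω ∩ (↑E₂ : Set (Sym2 V)))).Reachable b c}) := by
  ext ω
  simp only [Set.mem_inter_iff, Set.mem_setOf_eq, Set.inter_union_distrib_left]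
  exact GZGluing.notReach_hub_iff (ω₁ := ω ∩ ↑E₁) (ω₂ := ω ∩ ↑E₂) h₁ h₂ hS Set.inter_subset_right
    Set.inter_subset_right hac hbc

omit [Fintype V] in
/-- **`P(a isolated)` event of the union = intersection of the parts' events.** [folklore] -/
theorem Ia_union_eq (h₁ : ∀ e ∈ (↑E₁ : Set (Sym2 V)), ∀ z ∈ e, z ∈ V₁) (h₂ : ∀ e ∈ (↑E₂ : Set (Sym2 V)), ∀ z ∈ e, z ∈ V₂)
    (hS : V₁ ∩ V₂ ⊆ {a, b, c}) (hab : a ≠ b) (hac : a ≠ c) :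
    ({ω : Set (Sym2 V) | ¬(openGraph (ω ∩ ((↑E₁ : Set (Sym2 V)) ∪ ↑E₂))).Reachable a b} ∩ {ω : Set (Sym2 V) | ¬(openGraph (ω ∩ ((↑E₁ : Set (Sym2 V)) ∪ ↑E₂))).Reachable a c}) =
      ({ω : Set (Sym2 V) | ¬(openGraph (ω ∩ (↑E₁ : Set (Sym2 V)))).Reachable a b} ∩ {ω : Set (Sym2 V) | ¬(openGraph (ω ∩ (↑E₁ : Set (Sym2 V)))).Reachable a c}) ∩
        ({ω : Set (Sym2 V) | ¬(openGraph (ω ∩ (↑E₂ : Set (Sym2 V)))).Reachable a b} ∩ {ω : Set (Sym2 V) | ¬(openGraph (ω ∩ (↑E₂ : Set (Sym2 V)))).Reachable a c}) := by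
  ext ω
  simp only [Set.mem_inter_iff, Set.mem_setOf_eq, Set.inter_union_distrib_left]
  exact GZGluing.isolated_iff (ω₁ := ω ∩ ↑E₁) (ω₂ := ω ∩ ↑E₂) h₁ h₂ hS Set.inter_subset_right
    Set.inter_subset_right hab hac

omit [Fintype V] in
/-- **`P(b isolated)` event of the union = intersection of the parts' events.** [folklore] -/
theorem Ib_union_eq (h₁ : ∀ e ∈ (↑E₁ : Set (Sym2 V)), ∀ z ∈ e, z ∈ V₁) (h₂ : ∀ e ∈ (↑E₂ : Set (Sym2 V)), ∀ z ∈ e, z ∈ V₂)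
    (hS : V₁ ∩ V₂ ⊆ {a, b, c}) (hab : a ≠ b) (hbc : b ≠ c) :
    ({ω : Set (Sym2 V) | ¬(openGraph (ω ∩ ((↑E₁ : Set (Sym2 V)) ∪ ↑E₂))).Reachable a b} ∩ {ω : Set (Sym2 V) | ¬(openGraph (ω ∩ ((↑E₁ : Set (Sym2 V)) ∪ ↑E₂))).Reachable b c}) =
      ({ω : Set (Sym2 V) | ¬(openGraph (ω ∩ (↑E₁ : Set (Sym2 V)))).Reachable a b} ∩ {ω : Set (Sym2 V) | ¬(openGraph (ω ∩ (↑E₁ : Set (Sym2 V)))).Reachable b c}) ∩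
        ({ω : Set (Sym2 V) | ¬(openGraph (ω ∩ (↑E₂ : Set (Sym2 V)))).Reachable a b} ∩ {ω : Set (Sym2 V) | ¬(openGraph (ω ∩ (↑E₂ : Set (Sym2 V)))).Reachable b c}) := by
  have hS' : V₁ ∩ V₂ ⊆ {b, a, c} := by
    intro z hz; have := hS hz; simp only [Set.mem_insert_iff, Set.mem_singleton_iff] at this ⊢; tauto
  have key := fun (η₁ η₂ : Set (Sym2 V)) (hη₁ : η₁ ⊆ (↑E₁ : Set (Sym2 V))) (hη₂ : η₂ ⊆ (↑E₂ : Set (Sym2 V))) =>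
    GZGluing.isolated_iff (ω₁ := η₁) (ω₂ := η₂) (a := b) (b := a) (c := c) h₁ h₂ hS' hη₁ hη₂ hab.symm hbc
  ext ω
  simp only [Set.mem_inter_iff, Set.mem_setOf_eq, Set.inter_union_distrib_left]
  have k := key (ω ∩ ↑E₁) (ω ∩ ↑E₂) Set.inter_subset_right Set.inter_subset_right
  simp only [SimpleGraph.reachable_comm (u := b) (v := a)] at k
  exact k

omit [Fintype V] in
/-- **`P(a|b|c)` event of the union = intersection of the parts' events.** [folklore] -/
theorem N_union_eq (h₁ : ∀ e ∈ (↑E₁ : Set (Sym2 V)), ∀ z ∈ e, z ∈ V₁) (h₂ : ∀ e ∈ (↑E₂ : Set (Sym2 V)), ∀ z ∈ e, z ∈ V₂)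
    (hS : V₁ ∩ V₂ ⊆ {a, b, c}) (hab : a ≠ b) (hac : a ≠ c) (hbc : b ≠ c) :
    ({ω : Set (Sym2 V) | ¬(openGraph (ω ∩ ((↑E₁ : Set (Sym2 V)) ∪ ↑E₂))).Reachable a b} ∩ {ω : Set (Sym2 V) | ¬(openGraph (ω ∩ ((↑E₁ : Set (Sym2 V)) ∪ ↑E₂))).Reachable a c} ∩ {ω : Set (Sym2 V) | ¬(openGraph (ω ∩ ((↑E₁ : Set (Sym2 V)) ∪ ↑E₂))).Reachable b c}) =
      ({ω : Set (Sym2 V) | ¬(openGraph (ω ∩ (↑E₁ : Set (Sym2 V)))).Reachable a b} ∩ {ω : Set (Sym2 V) | ¬(openGraph (ω ∩ (↑E₁ : Set (Sym2 V)))).Reachable a c} ∩ {ω : Set (Sym2 V) | ¬(openGraph (ω ∩ (↑E₁ : Set (Sym2 V)))).Reachable b c}) ∩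
        ({ω : Set (Sym2 V) | ¬(openGraph (ω ∩ (↑E₂ : Set (Sym2 V)))).Reachable a b} ∩ {ω : Set (Sym2 V) | ¬(openGraph (ω ∩ (↑E₂ : Set (Sym2 V)))).Reachable a c} ∩ {ω : Set (Sym2 V) | ¬(openGraph (ω ∩ (↑E₂ : Set (Sym2 V)))).Reachable b c}) := by
  have hIa := Ia_union_eq h₁ h₂ hS hab hac
  have hZ := Z_union_eq h₁ h₂ hS hac hbc
  ext ω
  have e1 := Set.ext_iff.1 hIa ω
  have e2 := Set.ext_iff.1 hZ ω
  simp only [Set.mem_inter_iff, Set.mem_setOf_eq] at e1 e2 ⊢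
  constructor
  · rintro ⟨⟨hD, hA⟩, hB⟩
    exact ⟨⟨⟨(e1.1 ⟨hD, hA⟩).1.1, (e1.1 ⟨hD, hA⟩).1.2⟩, (e2.1 ⟨hA, hB⟩).1.2⟩,
      ⟨⟨(e1.1 ⟨hD, hA⟩).2.1, (e1.1 ⟨hD, hA⟩).2.2⟩, (e2.1 ⟨hA, hB⟩).2.2⟩⟩
  · rintro ⟨⟨⟨hD1, hA1⟩, hB1⟩, ⟨⟨hD2, hA2⟩, hB2⟩⟩
    exact ⟨⟨(e1.2 ⟨⟨hD1, hA1⟩, ⟨hD2, hA2⟩⟩).1, (e1.2 ⟨⟨hD1, hA1⟩, ⟨hD2, hA2⟩⟩).2⟩, (e2.2 ⟨⟨hA1, hB1⟩, ⟨hA2, hB2⟩⟩).2⟩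

omit [Fintype V] in
/-- **`{a ↔ b off c}` of the union = union of the parts' events.** [folklore] -/
theorem T_union_eq (h₁ : ∀ e ∈ (↑E₁ : Set (Sym2 V)), ∀ z ∈ e, z ∈ V₁) (h₂ : ∀ e ∈ (↑E₂ : Set (Sym2 V)), ∀ z ∈ e, z ∈ V₂)
    (hS : V₁ ∩ V₂ ⊆ {a, b, c}) (hac : a ≠ c) :
    {ω : Set (Sym2 V) | (openGraph ((ω ∩ ((↑E₁ : Set (Sym2 V)) ∪ ↑E₂)) \ {e : Sym2 V | c ∈ e})).Reachable a b} =
      {ω : Set (Sym2 V) | (openGraph ((ω ∩ (↑E₁ : Set (Sym2 V))) \ {e : Sym2 V | c ∈ e})).Reachable a b} ∪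
        {ω : Set (Sym2 V) | (openGraph ((ω ∩ (↑E₂ : Set (Sym2 V))) \ {e : Sym2 V | c ∈ e})).Reachable a b} := by
  ext ω
  simp only [Set.mem_union, Set.mem_setOf_eq, Set.inter_union_distrib_left]
  exact GZGluing.reach_off_iff (ω₁ := ω ∩ ↑E₁) (ω₂ := ω ∩ ↑E₂) h₁ h₂ hS Set.inter_subset_right
    Set.inter_subset_right hac

/-- **PARALLEL COMPOSITION LAW** (THEOREM-SP.md §2 (PAR)): for edge-disjoint sub-networks on vertex sets meeting
inside `{a, b, c}`, the probabilities `P(a↮c, b↮c)`, `P(a isolated)`, `P(b isolated)`, `P(a|b|c)` multiply and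
`1 − P(a ↔ b off c)` multiplies. [folklore] -/
theorem parallel_law (w : Sym2 V → unitInterval)
    (h₁ : ∀ e ∈ (↑E₁ : Set (Sym2 V)), ∀ z ∈ e, z ∈ V₁) (h₂ : ∀ e ∈ (↑E₂ : Set (Sym2 V)), ∀ z ∈ e, z ∈ V₂)
    (hS : V₁ ∩ V₂ ⊆ {a, b, c}) (hdisj : Disjoint E₁ E₂) (hab : a ≠ b) (hac : a ≠ c) (hbc : b ≠ c) :
    (prodBernoulli w).real ({ω : Set (Sym2 V) | ¬(openGraph (ω ∩ ((↑E₁ : Set (Sym2 V)) ∪ ↑E₂))).Reachable a c} ∩ {ω : Set (Sym2 V) | ¬(openGraph (ω ∩ ((↑E₁ : Set (Sym2 V)) ∪ ↑E₂))).Reachable b c}) =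
        (prodBernoulli w).real ({ω : Set (Sym2 V) | ¬(openGraph (ω ∩ (↑E₁ : Set (Sym2 V)))).Reachable a c} ∩ {ω : Set (Sym2 V) | ¬(openGraph (ω ∩ (↑E₁ : Set (Sym2 V)))).Reachable b c}) *
          (prodBernoulli w).real ({ω : Set (Sym2 V) | ¬(openGraph (ω ∩ (↑E₂ : Set (Sym2 V)))).Reachable a c} ∩ {ω : Set (Sym2 V) | ¬(openGraph (ω ∩ (↑E₂ : Set (Sym2 V)))).Reachable b c}) ∧
    (prodBernoulli w).real ({ω : Set (Sym2 V) | ¬(openGraph (ω ∩ ((↑E₁ : Set (Sym2 V)) ∪ ↑E₂))).Reachable a b} ∩ {ω : Set (Sym2 V) | ¬(openGraph (ω ∩ ((↑E₁ : Set (Sym2 V)) ∪ ↑E₂))).Reachable a c}) =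
        (prodBernoulli w).real ({ω : Set (Sym2 V) | ¬(openGraph (ω ∩ (↑E₁ : Set (Sym2 V)))).Reachable a b} ∩ {ω : Set (Sym2 V) | ¬(openGraph (ω ∩ (↑E₁ : Set (Sym2 V)))).Reachable a c}) *
          (prodBernoulli w).real ({ω : Set (Sym2 V) | ¬(openGraph (ω ∩ (↑E₂ : Set (Sym2 V)))).Reachable a b} ∩ {ω : Set (Sym2 V) | ¬(openGraph (ω ∩ (↑E₂ : Set (Sym2 V)))).Reachable a c}) ∧
    (prodBernoulli w).real ({ω : Set (Sym2 V) | ¬(openGraph (ω ∩ ((↑E₁ : Set (Sym2 V)) ∪ ↑E₂))).Reachable a b} ∩ {ω : Set (Sym2 V) | ¬(openGraph (ω ∩ ((↑E₁ : Set (Sym2 V)) ∪ ↑E₂))).Reachable b c}) =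
        (prodBernoulli w).real ({ω : Set (Sym2 V) | ¬(openGraph (ω ∩ (↑E₁ : Set (Sym2 V)))).Reachable a b} ∩ {ω : Set (Sym2 V) | ¬(openGraph (ω ∩ (↑E₁ : Set (Sym2 V)))).Reachable b c}) *
          (prodBernoulli w).real ({ω : Set (Sym2 V) | ¬(openGraph (ω ∩ (↑E₂ : Set (Sym2 V)))).Reachable a b} ∩ {ω : Set (Sym2 V) | ¬(openGraph (ω ∩ (↑E₂ : Set (Sym2 V)))).Reachable b c}) ∧
    (prodBernoulli w).real ({ω : Set (Sym2 V) | ¬(openGraph (ω ∩ ((↑E₁ : Set (Sym2 V)) ∪ ↑E₂))).Reachable a b} ∩ {ω : Set (Sym2 V) | ¬(openGraph (ω ∩ ((↑E₁ : Set (Sym2 V)) ∪ ↑E₂))).Reachable a c} ∩ {ω : Set (Sym2 V) | ¬(openGraph (ω ∩ ((↑E₁ : Set (Sym2 V)) ∪ ↑E₂))).Reachable b c}) =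
        (prodBernoulli w).real ({ω : Set (Sym2 V) | ¬(openGraph (ω ∩ (↑E₁ : Set (Sym2 V)))).Reachable a b} ∩ {ω : Set (Sym2 V) | ¬(openGraph (ω ∩ (↑E₁ : Set (Sym2 V)))).Reachable a c} ∩ {ω : Set (Sym2 V) | ¬(openGraph (ω ∩ (↑E₁ : Set (Sym2 V)))).Reachable b c}) *
          (prodBernoulli w).real ({ω : Set (Sym2 V) | ¬(openGraph (ω ∩ (↑E₂ : Set (Sym2 V)))).Reachable a b} ∩ {ω : Set (Sym2 V) | ¬(openGraph (ω ∩ (↑E₂ : Set (Sym2 V)))).Reachable a c} ∩ {ω : Set (Sym2 V) | ¬(openGraph (ω ∩ (↑E₂ : Set (Sym2 V)))).Reachable b c}) ∧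
    1 - (prodBernoulli w).real {ω : Set (Sym2 V) | (openGraph ((ω ∩ ((↑E₁ : Set (Sym2 V)) ∪ ↑E₂)) \ {e : Sym2 V | c ∈ e})).Reachable a b} =
        (1 - (prodBernoulli w).real {ω : Set (Sym2 V) | (openGraph ((ω ∩ (↑E₁ : Set (Sym2 V))) \ {e : Sym2 V | c ∈ e})).Reachable a b}) *
          (1 - (prodBernoulli w).real {ω : Set (Sym2 V) | (openGraph ((ω ∩ (↑E₂ : Set (Sym2 V))) \ {e : Sym2 V | c ∈ e})).Reachable a b}) := by
  have hm : ∀ S : Set (Set (Sym2 V)), MeasurableSet S := fun S => MeasurableSet.of_discrete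
  refine ⟨?_, ?_, ?_, ?_, ?_⟩
  · rw [Z_union_eq h₁ h₂ hS hac hbc]
    exact real_inter_restrict w hdisj (fun η => ¬(openGraph η).Reachable a c ∧ ¬(openGraph η).Reachable b c)
      (fun η => ¬(openGraph η).Reachable a c ∧ ¬(openGraph η).Reachable b c)
  · rw [Ia_union_eq h₁ h₂ hS hab hac]
    exact real_inter_restrict w hdisj (fun η => ¬(openGraph η).Reachable a b ∧ ¬(openGraph η).Reachable a c)
      (fun η => ¬(openGraph η).Reachable a b ∧ ¬(openGraph η).Reachable a c)
  · rw [Ib_union_eq h₁ h₂ hS hab hbc]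
    exact real_inter_restrict w hdisj (fun η => ¬(openGraph η).Reachable a b ∧ ¬(openGraph η).Reachable b c)
      (fun η => ¬(openGraph η).Reachable a b ∧ ¬(openGraph η).Reachable b c)
  · rw [N_union_eq h₁ h₂ hS hab hac hbc]
    exact real_inter_restrict w hdisj
      (fun η => (¬(openGraph η).Reachable a b ∧ ¬(openGraph η).Reachable a c) ∧ ¬(openGraph η).Reachable b c)
      (fun η => (¬(openGraph η).Reachable a b ∧ ¬(openGraph η).Reachable a c) ∧ ¬(openGraph η).Reachable b c)
  · rw [← probReal_compl_eq_one_sub (hm _), ← probReal_compl_eq_one_sub (hm _), ← probReal_compl_eq_one_sub (hm _),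
      T_union_eq h₁ h₂ hS hac, Set.compl_union]
    exact real_inter_restrict w hdisj
      (fun η => ¬(openGraph (η \ {e : Sym2 V | c ∈ e})).Reachable a b)
      (fun η => ¬(openGraph (η \ {e : Sym2 V | c ∈ e})).Reachable a b)

set_option maxHeartbeats 400000 in
/-- The parallel step from the cell facts alone (pure real arithmetic; the bridge between `network_facts`,
`parallel_law` and `GZParallel.parallel_cov_le_mul_log`). [folklore] -/
theorem parallel_cov_le_of_facts
    {z₁ n₁ u₁ v₁ θ₁ a₁ b₁ z₂ n₂ u₂ v₂ θ₂ a₂ b₂ z n u v θ a bb : ℝ}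
    (f1u : u₁ = z₁ + a₁ - n₁) (f1v : v₁ = z₁ + b₁ - n₁) (f1xa : n₁ ≤ a₁) (f1xb : n₁ ≤ b₁)
    (f1t : z₁ - n₁ ≤ θ₁) (f1q : θ₁ + a₁ + b₁ - n₁ ≤ 1) (f1H3 : u₁ * b₁ ≤ n₁) (f1H4 : v₁ * a₁ ≤ n₁)
    (f2u : u₂ = z₂ + a₂ - n₂) (f2v : v₂ = z₂ + b₂ - n₂) (f2xa : n₂ ≤ a₂) (f2xb : n₂ ≤ b₂)
    (f2t : z₂ - n₂ ≤ θ₂) (f2q : θ₂ + a₂ + b₂ - n₂ ≤ 1) (f2H3 : u₂ * b₂ ≤ n₂) (f2H4 : v₂ * a₂ ≤ n₂)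
    (fu : u = z + a - n) (fv : v = z + bb - n)
    (pz : z = z₁ * z₂) (pa : a = a₁ * a₂) (pb : bb = b₁ * b₂) (pn : n = n₁ * n₂) (pθ : 1 - θ = (1 - θ₁) * (1 - θ₂))
    (hn₁ : 0 < n₁) (hn₂ : 0 < n₂) (hw₁ : n₁ < z₁) (hw₂ : n₂ < z₂)
    (L₁ : z₁ - u₁ * v₁ ≤ (z₁ - n₁) * Real.log (θ₁ / (z₁ - n₁)))
    (L₂ : z₂ - u₂ * v₂ ≤ (z₂ - n₂) * Real.log (θ₂ / (z₂ - n₂))) :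
    z - u * v ≤ (z - n) * Real.log (θ / (z - n)) := by
  have key := GZParallel.parallel_cov_le_mul_log
    (t₁ := θ₁ - (z₁ - n₁)) (w₁ := z₁ - n₁) (q₁ := 1 - θ₁ - a₁ - b₁ + n₁) (x₁ := a₁ - n₁) (y₁ := b₁ - n₁) (n₁ := n₁)
    (t₂ := θ₂ - (z₂ - n₂)) (w₂ := z₂ - n₂) (q₂ := 1 - θ₂ - a₂ - b₂ + n₂) (x₂ := a₂ - n₂) (y₂ := b₂ - n₂) (n₂ := n₂)
    (by linarith) (by linarith) (by linarith) (by linarith) (by linarith) hn₁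
    (by linarith) (by linarith) (by linarith) (by linarith) (by linarith) hn₂
    (by ring) (by ring)
    (by rw [f1u] at f1H3; nlinarith [f1H3]) (by rw [f1v] at f1H4; nlinarith [f1H4])
    (by rw [f2u] at f2H3; nlinarith [f2H3]) (by rw [f2v] at f2H4; nlinarith [f2H4])
    (by
      have e1 : (z₁ - n₁ + n₁) * (θ₁ - (z₁ - n₁) + (1 - θ₁ - a₁ - b₁ + n₁)) - (a₁ - n₁) * (b₁ - n₁) = z₁ - u₁ * v₁ := by
        rw [f1u, f1v]; ring
      have e2 : θ₁ - (z₁ - n₁) + (z₁ - n₁) = θ₁ := by ring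
      rw [e1, e2]; exact L₁)
    (by
      have e1 : (z₂ - n₂ + n₂) * (θ₂ - (z₂ - n₂) + (1 - θ₂ - a₂ - b₂ + n₂)) - (a₂ - n₂) * (b₂ - n₂) = z₂ - u₂ * v₂ := by
        rw [f2u, f2v]; ring
      have e2 : θ₂ - (z₂ - n₂) + (z₂ - n₂) = θ₂ := by ring
      rw [e1, e2]; exact L₂)
  have ez : (z₁ - n₁ + n₁) * (z₂ - n₂ + n₂) = z := by rw [pz]; ring
  have en : n₁ * n₂ = n := pn.symm
  have ea : (n₁ + (a₁ - n₁)) * (n₂ + (a₂ - n₂)) = a := by rw [pa]; ring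
  have eb : (n₁ + (b₁ - n₁)) * (n₂ + (b₂ - n₂)) = bb := by rw [pb]; ring
  have eθ : θ₁ - (z₁ - n₁) + (z₁ - n₁) + (θ₂ - (z₂ - n₂) + (z₂ - n₂)) -
      (θ₁ - (z₁ - n₁) + (z₁ - n₁)) * (θ₂ - (z₂ - n₂) + (z₂ - n₂)) = θ := by linear_combination pθ
  rw [ez, en, ea, eb, eθ] at key
  have eu : a + (z - n) = u := by rw [fu]; ring
  have ev : bb + (z - n) = v := by rw [fv]; ring
  rw [eu, ev] at key
  exact key

/-- **Parallel step of THEOREM SP for weighted graphs** (THEOREM-SP.md §4 with §2 (PAR), §3).  Two edge-disjoint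
sub-networks `E₁, E₂` on vertex sets meeting inside `{a, b, c}`, each non-degenerate (`P(a|b|c) > 0`, `P(ab|c) > 0`) and
each satisfying the logarithmic covariance bound `Cov(1{a↔c},1{b↔c}) ≤ P(ab|c)·log(P(a ↔ b off c)/P(ab|c))` (events read
on `ω ∩ Eᵢ`; `Cov = P(a↮c,b↮c) − P(a↮c)P(b↮c)`, `P(ab|c) = P(a↮c,b↮c) − P(a|b|c)`): then the union `E₁ ∪ E₂` satisfies it.
Proof: `network_facts` (cells + Harris), `parallel_law` (product structure), `parallel_cov_le_of_facts`. -/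
theorem parallel_cov_le (w : Sym2 V → unitInterval) {E₁ E₂ : Finset (Sym2 V)} {V₁ V₂ : Set V} {a b c : V}
    (h₁ : ∀ e ∈ (↑E₁ : Set (Sym2 V)), ∀ z ∈ e, z ∈ V₁) (h₂ : ∀ e ∈ (↑E₂ : Set (Sym2 V)), ∀ z ∈ e, z ∈ V₂)
    (hS : V₁ ∩ V₂ ⊆ {a, b, c}) (hdisj : Disjoint E₁ E₂) (hab : a ≠ b) (hac : a ≠ c) (hbc : b ≠ c)
    (hn₁ : 0 < (prodBernoulli w).real ({ω : Set (Sym2 V) | ¬(openGraph (ω ∩ (↑E₁ : Set (Sym2 V)))).Reachable a b} ∩ {ω : Set (Sym2 V) | ¬(openGraph (ω ∩ (↑E₁ : Set (Sym2 V)))).Reachable a c} ∩ {ω : Set (Sym2 V) | ¬(openGraph (ω ∩ (↑E₁ : Set (Sym2 V)))).Reachable b c}))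
    (hn₂ : 0 < (prodBernoulli w).real ({ω : Set (Sym2 V) | ¬(openGraph (ω ∩ (↑E₂ : Set (Sym2 V)))).Reachable a b} ∩ {ω : Set (Sym2 V) | ¬(openGraph (ω ∩ (↑E₂ : Set (Sym2 V)))).Reachable a c} ∩ {ω : Set (Sym2 V) | ¬(openGraph (ω ∩ (↑E₂ : Set (Sym2 V)))).Reachable b c}))
    (hw₁ : (prodBernoulli w).real ({ω : Set (Sym2 V) | ¬(openGraph (ω ∩ (↑E₁ : Set (Sym2 V)))).Reachable a b} ∩ {ω : Set (Sym2 V) | ¬(openGraph (ω ∩ (↑E₁ : Set (Sym2 V)))).Reachable a c} ∩ {ω : Set (Sym2 V) | ¬(openGraph (ω ∩ (↑E₁ : Set (Sym2 V)))).Reachable b c}) <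
      (prodBernoulli w).real ({ω : Set (Sym2 V) | ¬(openGraph (ω ∩ (↑E₁ : Set (Sym2 V)))).Reachable a c} ∩ {ω : Set (Sym2 V) | ¬(openGraph (ω ∩ (↑E₁ : Set (Sym2 V)))).Reachable b c}))
    (hw₂ : (prodBernoulli w).real ({ω : Set (Sym2 V) | ¬(openGraph (ω ∩ (↑E₂ : Set (Sym2 V)))).Reachable a b} ∩ {ω : Set (Sym2 V) | ¬(openGraph (ω ∩ (↑E₂ : Set (Sym2 V)))).Reachable a c} ∩ {ω : Set (Sym2 V) | ¬(openGraph (ω ∩ (↑E₂ : Set (Sym2 V)))).Reachable b c}) <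
      (prodBernoulli w).real ({ω : Set (Sym2 V) | ¬(openGraph (ω ∩ (↑E₂ : Set (Sym2 V)))).Reachable a c} ∩ {ω : Set (Sym2 V) | ¬(openGraph (ω ∩ (↑E₂ : Set (Sym2 V)))).Reachable b c}))
    (L₁ : (prodBernoulli w).real ({ω : Set (Sym2 V) | ¬(openGraph (ω ∩ (↑E₁ : Set (Sym2 V)))).Reachable a c} ∩ {ω : Set (Sym2 V) | ¬(openGraph (ω ∩ (↑E₁ : Set (Sym2 V)))).Reachable b c}) -
        (prodBernoulli w).real {ω : Set (Sym2 V) | ¬(openGraph (ω ∩ (↑E₁ : Set (Sym2 V)))).Reachable a c} *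
          (prodBernoulli w).real {ω : Set (Sym2 V) | ¬(openGraph (ω ∩ (↑E₁ : Set (Sym2 V)))).Reachable b c} ≤
      ((prodBernoulli w).real ({ω : Set (Sym2 V) | ¬(openGraph (ω ∩ (↑E₁ : Set (Sym2 V)))).Reachable a c} ∩ {ω : Set (Sym2 V) | ¬(openGraph (ω ∩ (↑E₁ : Set (Sym2 V)))).Reachable b c}) -
          (prodBernoulli w).real ({ω : Set (Sym2 V) | ¬(openGraph (ω ∩ (↑E₁ : Set (Sym2 V)))).Reachable a b} ∩ {ω : Set (Sym2 V) | ¬(openGraph (ω ∩ (↑E₁ : Set (Sym2 V)))).Reachable a c} ∩ {ω : Set (Sym2 V) | ¬(openGraph (ω ∩ (↑E₁ : Set (Sym2 V)))).Reachable b c})) *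
        Real.log ((prodBernoulli w).real {ω : Set (Sym2 V) | (openGraph ((ω ∩ (↑E₁ : Set (Sym2 V))) \ {e : Sym2 V | c ∈ e})).Reachable a b} /
          ((prodBernoulli w).real ({ω : Set (Sym2 V) | ¬(openGraph (ω ∩ (↑E₁ : Set (Sym2 V)))).Reachable a c} ∩ {ω : Set (Sym2 V) | ¬(openGraph (ω ∩ (↑E₁ : Set (Sym2 V)))).Reachable b c}) -
            (prodBernoulli w).real ({ω : Set (Sym2 V) | ¬(openGraph (ω ∩ (↑E₁ : Set (Sym2 V)))).Reachable a b} ∩ {ω : Set (Sym2 V) | ¬(openGraph (ω ∩ (↑E₁ : Set (Sym2 V)))).Reachable a c} ∩ {ω : Set (Sym2 V) | ¬(openGraph (ω ∩ (↑E₁ : Set (Sym2 V)))).Reachable b c}))))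
    (L₂ : (prodBernoulli w).real ({ω : Set (Sym2 V) | ¬(openGraph (ω ∩ (↑E₂ : Set (Sym2 V)))).Reachable a c} ∩ {ω : Set (Sym2 V) | ¬(openGraph (ω ∩ (↑E₂ : Set (Sym2 V)))).Reachable b c}) -
        (prodBernoulli w).real {ω : Set (Sym2 V) | ¬(openGraph (ω ∩ (↑E₂ : Set (Sym2 V)))).Reachable a c} *
          (prodBernoulli w).real {ω : Set (Sym2 V) | ¬(openGraph (ω ∩ (↑E₂ : Set (Sym2 V)))).Reachable b c} ≤
      ((prodBernoulli w).real ({ω : Set (Sym2 V) | ¬(openGraph (ω ∩ (↑E₂ : Set (Sym2 V)))).Reachable a c} ∩ {ω : Set (Sym2 V) | ¬(openGraph (ω ∩ (↑E₂ : Set (Sym2 V)))).Reachable b c}) -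
          (prodBernoulli w).real ({ω : Set (Sym2 V) | ¬(openGraph (ω ∩ (↑E₂ : Set (Sym2 V)))).Reachable a b} ∩ {ω : Set (Sym2 V) | ¬(openGraph (ω ∩ (↑E₂ : Set (Sym2 V)))).Reachable a c} ∩ {ω : Set (Sym2 V) | ¬(openGraph (ω ∩ (↑E₂ : Set (Sym2 V)))).Reachable b c})) *
        Real.log ((prodBernoulli w).real {ω : Set (Sym2 V) | (openGraph ((ω ∩ (↑E₂ : Set (Sym2 V))) \ {e : Sym2 V | c ∈ e})).Reachable a b} /
          ((prodBernoulli w).real ({ω : Set (Sym2 V) | ¬(openGraph (ω ∩ (↑E₂ : Set (Sym2 V)))).Reachable a c} ∩ {ω : Set (Sym2 V) | ¬(openGraph (ω ∩ (↑E₂ : Set (Sym2 V)))).Reachable b c}) -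
            (prodBernoulli w).real ({ω : Set (Sym2 V) | ¬(openGraph (ω ∩ (↑E₂ : Set (Sym2 V)))).Reachable a b} ∩ {ω : Set (Sym2 V) | ¬(openGraph (ω ∩ (↑E₂ : Set (Sym2 V)))).Reachable a c} ∩ {ω : Set (Sym2 V) | ¬(openGraph (ω ∩ (↑E₂ : Set (Sym2 V)))).Reachable b c})))) :
    (prodBernoulli w).real ({ω : Set (Sym2 V) | ¬(openGraph (ω ∩ ((↑E₁ : Set (Sym2 V)) ∪ ↑E₂))).Reachable a c} ∩ {ω : Set (Sym2 V) | ¬(openGraph (ω ∩ ((↑E₁ : Set (Sym2 V)) ∪ ↑E₂))).Reachable b c}) -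
        (prodBernoulli w).real {ω : Set (Sym2 V) | ¬(openGraph (ω ∩ ((↑E₁ : Set (Sym2 V)) ∪ ↑E₂))).Reachable a c} *
          (prodBernoulli w).real {ω : Set (Sym2 V) | ¬(openGraph (ω ∩ ((↑E₁ : Set (Sym2 V)) ∪ ↑E₂))).Reachable b c} ≤
      ((prodBernoulli w).real ({ω : Set (Sym2 V) | ¬(openGraph (ω ∩ ((↑E₁ : Set (Sym2 V)) ∪ ↑E₂))).Reachable a c} ∩ {ω : Set (Sym2 V) | ¬(openGraph (ω ∩ ((↑E₁ : Set (Sym2 V)) ∪ ↑E₂))).Reachable b c}) -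
          (prodBernoulli w).real ({ω : Set (Sym2 V) | ¬(openGraph (ω ∩ ((↑E₁ : Set (Sym2 V)) ∪ ↑E₂))).Reachable a b} ∩ {ω : Set (Sym2 V) | ¬(openGraph (ω ∩ ((↑E₁ : Set (Sym2 V)) ∪ ↑E₂))).Reachable a c} ∩ {ω : Set (Sym2 V) | ¬(openGraph (ω ∩ ((↑E₁ : Set (Sym2 V)) ∪ ↑E₂))).Reachable b c})) *
        Real.log ((prodBernoulli w).real {ω : Set (Sym2 V) | (openGraph ((ω ∩ ((↑E₁ : Set (Sym2 V)) ∪ ↑E₂)) \ {e : Sym2 V | c ∈ e})).Reachable a b} /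
          ((prodBernoulli w).real ({ω : Set (Sym2 V) | ¬(openGraph (ω ∩ ((↑E₁ : Set (Sym2 V)) ∪ ↑E₂))).Reachable a c} ∩ {ω : Set (Sym2 V) | ¬(openGraph (ω ∩ ((↑E₁ : Set (Sym2 V)) ∪ ↑E₂))).Reachable b c}) -
            (prodBernoulli w).real ({ω : Set (Sym2 V) | ¬(openGraph (ω ∩ ((↑E₁ : Set (Sym2 V)) ∪ ↑E₂))).Reachable a b} ∩ {ω : Set (Sym2 V) | ¬(openGraph (ω ∩ ((↑E₁ : Set (Sym2 V)) ∪ ↑E₂))).Reachable a c} ∩ {ω : Set (Sym2 V) | ¬(openGraph (ω ∩ ((↑E₁ : Set (Sym2 V)) ∪ ↑E₂))).Reachable b c}))) := by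
  obtain ⟨f1u, f1v, f1xa, f1xb, -, f1t, f1q, f1H3, f1H4⟩ := network_facts w (↑E₁ : Set (Sym2 V)) (b := b) hac rfl rfl rfl rfl
  obtain ⟨f2u, f2v, f2xa, f2xb, -, f2t, f2q, f2H3, f2H4⟩ := network_facts w (↑E₂ : Set (Sym2 V)) (b := b) hac rfl rfl rfl rfl
  obtain ⟨fu, fv, -, -, -, -, -, -, -⟩ := network_facts w ((↑E₁ : Set (Sym2 V)) ∪ ↑E₂) (b := b) hac rfl rfl rfl rfl
  obtain ⟨pz, pa, pb, pn, pθ⟩ := parallel_law w h₁ h₂ hS hdisj hab hac hbc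
  exact parallel_cov_le_of_facts f1u f1v f1xa f1xb f1t f1q f1H3 f1H4 f2u f2v f2xa f2xb f2t f2q f2H3 f2H4
    fu fv pz pa pb pn pθ hn₁ hn₂ hw₁ hw₂ L₁ L₂

end parallel

end GZGluingLaw

end Summit.CriticalPhenomena.PercolationContinuityZ3.Theorems
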